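import Summits.CriticalPhenomena.PercolationContinuityZ3.Theorems.FK.Transplant.FreeBoundaryHypotheses
import Summits.CriticalPhenomena.PercolationContinuityZ3.Theorems.FK.Transplant.KNFreePinningLawRC
import Summits.CriticalPhenomena.PercolationContinuityZ3.Theorems.FK.Transplant.KNFreeLawSupport
import Summits.CriticalPhenomena.PercolationContinuityZ3.Theorems.FK.Transplant.KNFreeSeedsLift
import Summits.CriticalPhenomena.PercolationContinuityZ3.Theorems.FK.Transplant.KNFreePinningEmbedding
import Literature.Probability.LatticeModels.RandomClusterDomainMarkov
import HarnessLib

/-!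
# FK-continuity transplant, FT-06d: the transplant's law `W ↦ fkLaw Λ W q` is a pinning law

Cell `fk-continuity` (bschramm), FRONTIER TRANSPLANT sub-cell, registry row FT-06d; support file
(`--supports stmt-CriticalPhenomena-4575`); builds on p205010 (kernel theorem, internal audit signed; external
expert review pending). HONEST FRAMING: the transplant `ufsc0_of_freeBoundaryHypothesis_r0` this file serves is
CONDITIONAL on the free-boundary penetration hypothesis FH (open at the same `p` for `q > 1`; ⇔ GRC Conj. (5.103)
via the referee's calibration K1; barrier note `Literature.Barriers.CriticalPhenomena.SamePFreeBoundaryCriteria`);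
it is a typed reduction, not a proof of FK continuity. THIS file is unconditional finite-volume measure theory: no
named facts, no sorries, standard axioms; `FH` does not occur in it.

## What is here

`fkLaw Λ W q` (FT-01 `FreeBoundaryHypotheses.lean`) is the edge-weight random-cluster measure `rcMeasureW` of the
finite vertex type `↥Λ` with parameters `W ∘ Sym2.map Subtype.val`, pushed forward to `ℤ^d` by `liftEdges Λ`. This
file transports FT-06c's instance `isPinningLaw_rcMeasureW` along the push-forward:

* `isPinningLaw_fkLaw` — **for `1 ≤ q`, `W ↦ fkLaw Λ W q` is a pinning law** (`Transplant.IsPinningLaw`, FT-06b)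
  **on the domain `D_Λ = Set.range (Sym2.map Subtype.val)`** (the pairs with both members in `Λ`): probability;
  conditioning on the pattern of a finite `F ⊆ D_Λ` is the law of the KN-pinned weighting `pinW W F T`
  (Grimmett 2006 Thm. (3.7), FT-05's domain Markov identity); monotone in the weights on `D_Λ` for increasing
  events (Grimmett (3.22)); configurations lie in `D_Λ` a.s.; `{0,1}`-valued weights on `K ⊆ D_Λ` pin a.s.
  Consequently FT-06b's chain (36)–(37) and FT-06's `real_badFK_le_of_isPinningLaw` apply to the per-direction
  minimal law `P^x = fkLaw (S.Sx h e du) (S.Wfull h e du) q` of the transplant (binder h_bad).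
* the transport lemmas `liftEdges_preimage_localCylinder` (cylinders over `F ⊆ D_Λ` pull back to cylinders) and
  `pairsF_subset_range_sym2Map` (`pairsF Λ ⊆ D_Λ`).
The support change `fkLaw Λ' W q = fkLaw Λ W q` for `W` supported in `Λ ⊆ Λ'` is fkt-p3's `fkLaw_eq_of_subset`
(`KNFreeLawSupport.lean`), whose `fkLaw_real_apply` is used here; the injectivity/range lemmas of the lift are fkt-p1's
(`KNFreeSeedsLift.lean`, namespace `KNFree`).

## References

* G. Grimmett, *The Random-Cluster Model*, Springer 2006: §1.4 eq. (1.20), Thm. (3.7) p. 39, eq. (3.22). [Grimmett2006]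
* G. Kozma, S. Nitzan, arXiv:2401.12397 (2024), §4 pp. 27–31. [KozmaNitzan2024]
-/

noncomputable section

open MeasureTheory Finset
open scoped ENNReal Classical

namespace Summit.CriticalPhenomena.PercolationContinuityZ3.Theorems.FK

open Literature.Probability.Percolation Literature.Probability.LatticeModels
open Literature.Probability.Percolation.KozmaNitzan
open Transplant

variable {d : ℕ}

section Transport

variable (Λ : Finset (Site d))

/-- **Cylinders over pairs of `Λ` pull back to cylinders**: for `K ⊆ D_Λ`,
`liftEdges Λ ⁻¹' [ξ]_K = [m⁻¹ ξ]_{m⁻¹ K}`, `m = Sym2.map Subtype.val`. [cite: Grimmett2006, §4.2] -/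
theorem liftEdges_preimage_localCylinder {K ξ : Set (Sym2 (Site d))}
    (hK : K ⊆ Set.range (Sym2.map (Subtype.val : ↥Λ → Site d))) :
    liftEdges Λ ⁻¹' localCylinder K ξ =
      localCylinder (Sym2.map (Subtype.val : ↥Λ → Site d) ⁻¹' K) (Sym2.map (Subtype.val : ↥Λ → Site d) ⁻¹' ξ) := by
  have hinj := KNFree.sym2Map_val_injective Λ
  ext ω
  simp only [Set.mem_preimage, localCylinder, Set.mem_setOf_eq]
  constructor
  · intro h e' he'
    have h1 := h _ he'
    rw [mem_liftEdges_iff] at h1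
    constructor
    · intro hω; exact h1.1 ⟨e', hω, rfl⟩
    · intro hξ
      obtain ⟨e'', he'', heq⟩ := h1.2 hξ
      rwa [← hinj heq]
  · intro h e he
    obtain ⟨e', rfl⟩ := hK he
    rw [mem_liftEdges_iff]
    constructor
    · rintro ⟨e'', he'', heq⟩
      rw [hinj heq] at he''
      exact (h e' he).1 he''
    · intro hξ; exact ⟨e', (h e' he).2 hξ, rfl⟩

/-- The pairs of distinct vertices of `Λ` lie in `D_Λ`. [folklore] -/
theorem wireSet_subset_range_sym2Map :
    wireSet (↑Λ : Set (Site d)) ⊆ Set.range (Sym2.map (Subtype.val : ↥Λ → Site d)) := by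
  intro e he
  induction e using Sym2.ind with
  | h x y =>
    have hx : x ∈ Λ := he.1 x (Sym2.mem_mk_left x y)
    have hy : y ∈ Λ := he.1 y (Sym2.mem_mk_right x y)
    exact ⟨s(⟨x, hx⟩, ⟨y, hy⟩), rfl⟩

/-- `pairsF Λ ⊆ D_Λ` (the hypothesis `hD` of FT-06's `real_badFK_le_of_isPinningLaw` for `D = D_Λ`). [folklore] -/
theorem pairsF_subset_range_sym2Map :
    (↑(pairsF Λ) : Set (Sym2 (Site d))) ⊆ Set.range (Sym2.map (Subtype.val : ↥Λ → Site d)) := by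
  rw [coe_pairsF]
  exact wireSet_subset_range_sym2Map Λ

/-- KN-pinning commutes with reading the weights on `↥Λ`. [folklore] -/
theorem pinW_comp_sym2Map (W : Sym2 (Site d) → unitInterval) (F T : Set (Sym2 (Site d))) :
    (fun e : Sym2 ↥Λ => pinW W F T (Sym2.map Subtype.val e)) =
      pinW (fun e : Sym2 ↥Λ => W (Sym2.map Subtype.val e))
        (Sym2.map (Subtype.val : ↥Λ → Site d) ⁻¹' F) (Sym2.map (Subtype.val : ↥Λ → Site d) ⁻¹' T) := by
  funext e
  simp only [pinW_apply, Set.mem_preimage]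

end Transport

/-! ## The instance -/

/-- **`W ↦ fkLaw Λ W q` is a pinning law on `D_Λ = Set.range (Sym2.map Subtype.val)`** for `1 ≤ q`: transport of
`isPinningLaw_rcMeasureW` (FT-06c) along `liftEdges Λ` — (P) conditioning on a finite pattern inside `D_Λ` is
KN-pinning (Grimmett Thm. (3.7)), (M) weight-monotonicity on increasing events (3.22), (S) configurations lie in
`D_Λ`, (N) `{0,1}`-weights pin almost surely. [cite: Grimmett2006, Thm. (3.7) (p. 39) and eq. (3.22)] -/
theorem isPinningLaw_fkLaw (Λ : Finset (Site d)) {q : ℝ} (hq : 1 ≤ q) :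
    IsPinningLaw (fun W : Sym2 (Site d) → unitInterval => fkLaw Λ W q)
      (Set.range (Sym2.map (Subtype.val : ↥Λ → Site d))) := by
  have hq0 : 0 < q := one_pos.trans_le hq
  set m : Sym2 ↥Λ → Sym2 (Site d) := Sym2.map Subtype.val with hm
  have hRC := isPinningLaw_rcMeasureW (V := ↥Λ) hq (∅ : Set ↥Λ)
  have hmeasΛ : ∀ A' : Set (BondConfig ↥Λ), MeasurableSet A' := fun A' => (Set.toFinite A').measurableSet
  refine ⟨fun W => ?_, fun W F hF T hT A hA => ?_, fun W W' hle A hA hAm => ?_, fun W => ?_,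
    fun W K ξ hK hKc h1 h0 => ?_⟩
  · -- probability
    haveI := isProbabilityMeasure_rcMeasureW (fun e : Sym2 ↥Λ => W (Sym2.map Subtype.val e)) hq0 (∅ : Set ↥Λ)
    exact Measure.isProbabilityMeasure_map (measurable_of_finite (liftEdges Λ)).aemeasurable
  · -- (P) pinning
    have hcylm : MeasurableSet (localCylinder (↑F : Set (Sym2 (Site d))) ↑T) :=
      measurableSet_localCylinder F.finite_toSet.countable _
    have hTF : (m ⁻¹' (↑T : Set (Sym2 (Site d)))) ⊆ m ⁻¹' ↑F := Set.preimage_mono (Finset.coe_subset.2 hT)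
    rw [fkLaw_real_apply Λ W q (hA.inter hcylm), fkLaw_real_apply Λ W q hcylm, fkLaw_real_apply Λ _ q hA,
      Set.preimage_inter, liftEdges_preimage_localCylinder Λ hF,
      rcMeasureW_real_inter_localCylinder_pinW _ hq0 _ hTF, pinW_comp_sym2Map]
  · -- (M) monotonicity
    rw [fkLaw_real_apply Λ W q hAm, fkLaw_real_apply Λ W' q hAm]
    have hmono : Monotone (liftEdges Λ) := fun _ _ h => Set.image_mono h
    exact rcMeasureW_real_mono_weights (fun e => hle (m e) ⟨e, rfl⟩) hq _ (hA.preimage hmono)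
  · -- (S) support
    have hS : {ω : BondConfig (Site d) | ω ⊆ Set.range m} = localCylinder (Set.range m)ᶜ ∅ := by
      ext ω
      simp only [Set.mem_setOf_eq, localCylinder, Set.mem_compl_iff, Set.mem_empty_iff_false, iff_false]
      exact ⟨fun h e he heω => he (h heω), fun h e heω => by by_contra he; exact h e he heω⟩
    have hSm : MeasurableSet {ω : BondConfig (Site d) | ω ⊆ Set.range m} := by
      rw [hS]; exact measurableSet_localCylinder (Set.to_countable _) _
    rw [fkLaw_real_apply Λ W q hSm.compl, Set.preimage_compl]
    have : liftEdges Λ ⁻¹' {ω : BondConfig (Site d) | ω ⊆ Set.range m} = Set.univ :=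
      Set.eq_univ_of_forall fun ω => KNFree.liftEdges_subset_range Λ ω
    rw [this, Set.compl_univ, measureReal_empty]
  · -- (N) {0,1}-weights pin
    have hcylm : MeasurableSet (localCylinder K ξ) := measurableSet_localCylinder hKc _
    rw [fkLaw_real_apply Λ W q hcylm.compl, Set.preimage_compl, liftEdges_preimage_localCylinder Λ hK]
    exact rcMeasureW_real_compl_localCylinder_eq_zero _ hq0 _ (fun e he hξ => h1 (m e) he hξ)
      (fun e he hξ => h0 (m e) he hξ)

end Summit.CriticalPhenomena.PercolationContinuityZ3.Theorems.FK

end
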